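import Summits.QuantumFields.QCD.Theorems.ExtinctionBuildsQCD.Negative.WithoutTightCollapse

/-!
# Negative lemmas for the crux `TipPricing` (item stmt-QuantumFields-8967): the TIGHT clause of its
consequent `WindowExtinction` pins `m_crit(k) ≤ a_k M/Z_m(k)` — the index vanishes at every positive
bare mass

Route `SpectralDefectExtinction` (QCD), crux `TipPricing : TipNoBinding → WegnerEstimate → WindowExtinction`.
Refuter file (cdisprove seat): sorry-free, no positive route-item conclusion, neither hypothesis of the
crux used.  Builds on the sibling seat's `ExtinctionBuildsQCD/Negative/WithoutTightCollapse.lean`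
(Wilson positivity `re_star_dotProduct_wilsonDirac_mem`, the clause definitions `Extinct`/`Tight`).

* `negEigenvalueCount_eq_half` — for every torus side `L ≥ 1`, every `SU(3)` link field `U` and every
  bare mass `μ > 0`, exactly `6L⁴` of the `12L⁴` eigenvalues of the Hermitian Wilson–Dirac operator
  `Γ₅ D_W(U,μ,1)` are negative, i.e. the TIGHT integrand `|n₋ − 6(2L_k+1)⁴|` of `WindowExtinction` is
  identically `0` at any positive TIGHT mass.  Proof: Ostrowski–Schneider / Lyapunov inertia —
  `HΓ₅ + Γ₅H = D + Dᴴ ≽ 2μ`, so the negative spectral subspace meets the `Γ₅ = +1` chirality block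
  trivially and the positive one meets `Γ₅ = −1` trivially; a dimension count
  (`LinearMap.ker_ne_bot_of_finrank_lt`) bounds both by `6L⁴`, and `det H ≠ 0` excludes zero modes.
* `mcrit_le_window_of_tight` — hence any regularisation satisfying the TIGHT clause has, for every
  `M > M₀`, eventually `m_crit(k) ≤ a_k M/Z_m(k)` (`limsup m_crit ≤ 0` since `a_k/Z_m(k) → 0`); with the
  sibling file's `extinct_of_mcrit_nonneg` (EXTINCT free on `m_crit ≥ 0`) this localises every witness
  of `WindowExtinction`: the pin that kills the EXTINCT-trivial witnesses `m_crit(k) > a_k M₀⁺/Z_m(k)`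
  is pure linear algebra; only the sliver `0 ≤ m_crit(k) ≤ a_k M₀/Z_m(k)` and the physical negative
  branch need gauge-integral estimates.
* `windowExtinction_mcrit_le_window` — the same pin read off the route decl `WindowExtinction` itself.
-/

namespace Summit.QuantumFields.QCD.Theorems.TipPricing.Negative

open Summit.QuantumFields.QCD.Theses.SpectralDefectExtinction
open Summit.QuantumFields.QCD.Theorems.ExtinctionBuildsQCD.Negative
open Literature.MathematicalPhysics.QuantumLattice Literature.MathematicalPhysics.QuantumFieldTheory
  Literature.Probability.LatticeModels
open Matrix MeasureTheory Filter
open scoped Classical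

variable {L : ℕ} [NeZero L]

/-- `Γ₅ v` entrywise: a sign `ε_{spin} ∈ {1,1,-1,-1}` times `v`. -/
theorem spinorLift_gammaFive_mulVec (v : QuarkIdx L → ℂ) (p : QuarkIdx L) :
    (spinorLift gammaFive *ᵥ v) p = (![1, 1, -1, -1] : Fin 4 → ℂ) p.2.2 * v p := by
  rw [spinorLift_gammaFive_eq_diagonal, mulVec_diagonal]

/-! ## The index vanishes at positive bare mass (Lyapunov inertia) -/

/-- Diagonalisation of the quadratic form of a Hermitian matrix in its eigenvector unitary `V`:
`⟨Vc, A Vc⟩ = Σ_i λ_i ‖c_i‖²`. -/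
theorem quadForm_eigenvectorUnitary_mulVec {n : Type*} [Fintype n] [DecidableEq n]
    {A : Matrix n n ℂ} (hA : A.IsHermitian) (c : n → ℂ) :
    star ((hA.eigenvectorUnitary : Matrix n n ℂ) *ᵥ c) ⬝ᵥ
        (A *ᵥ ((hA.eigenvectorUnitary : Matrix n n ℂ) *ᵥ c)) =
      ∑ i, (hA.eigenvalues i : ℂ) * ‖c i‖ ^ 2 := by
  set V : Matrix n n ℂ := (hA.eigenvectorUnitary : Matrix n n ℂ) with hV
  have hVV : star V * V = 1 := Matrix.mem_unitaryGroup_iff'.mp hA.eigenvectorUnitary.2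
  have hspec : star V * (A * V) = diagonal (RCLike.ofReal ∘ hA.eigenvalues) := by
    have h : A = V * diagonal (RCLike.ofReal ∘ hA.eigenvalues) * star V := by
      have h0 := hA.spectral_theorem
      rw [Unitary.conjStarAlgAut_apply] at h0
      exact h0
    calc star V * (A * V) = star V * (V * diagonal (RCLike.ofReal ∘ hA.eigenvalues) * star V * V) := by
          rw [← h]
      _ = (star V * V) * diagonal (RCLike.ofReal ∘ hA.eigenvalues) * (star V * V) := by
          simp only [Matrix.mul_assoc]
      _ = diagonal (RCLike.ofReal ∘ hA.eigenvalues) := by rw [hVV, Matrix.one_mul, Matrix.mul_one]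
  rw [star_mulVec, mulVec_mulVec, ← dotProduct_mulVec, mulVec_mulVec, ← star_eq_conjTranspose,
    hspec, dotProduct]
  refine Finset.sum_congr rfl fun i _ => ?_
  rw [mulVec_diagonal, Pi.star_apply, Function.comp_apply, Complex.star_def, mul_left_comm,
    ← Complex.normSq_eq_conj_mul_self, Complex.normSq_eq_norm_sq]
  push_cast
  rfl

/-- Lower chirality components zero ⇒ `⟨v, Γ₅ w⟩ = ⟨v, w⟩`. -/
theorem dotProduct_gammaFive_mulVec_of_lower_eq_zero (v w : QuarkIdx L → ℂ)
    (hv : ∀ p : QuarkIdx L, (p.2.2 = 2 ∨ p.2.2 = 3) → v p = 0) :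
    star v ⬝ᵥ (spinorLift gammaFive *ᵥ w) = star v ⬝ᵥ w := by
  simp only [dotProduct]
  refine Finset.sum_congr rfl fun p _ => ?_
  rw [spinorLift_gammaFive_mulVec, Pi.star_apply]
  obtain ⟨x, a, α⟩ := p
  fin_cases α
  · simp
  · simp
  · simp [hv (x, a, 2) (Or.inl rfl)]
  · simp [hv (x, a, 3) (Or.inr rfl)]

/-- Upper chirality components zero ⇒ `⟨v, Γ₅ w⟩ = -⟨v, w⟩`. -/
theorem dotProduct_gammaFive_mulVec_of_upper_eq_zero (v w : QuarkIdx L → ℂ)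
    (hv : ∀ p : QuarkIdx L, (p.2.2 = 0 ∨ p.2.2 = 1) → v p = 0) :
    star v ⬝ᵥ (spinorLift gammaFive *ᵥ w) = -(star v ⬝ᵥ w) := by
  simp only [dotProduct, ← Finset.sum_neg_distrib]
  refine Finset.sum_congr rfl fun p _ => ?_
  rw [spinorLift_gammaFive_mulVec, Pi.star_apply]
  obtain ⟨x, a, α⟩ := p
  fin_cases α
  · simp [hv (x, a, 0) (Or.inl rfl)]
  · simp [hv (x, a, 1) (Or.inr rfl)]
  · simp
  · simp

/-- `12 L⁴ / 2`: the number of quark indices with spin in a two-element set. -/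
theorem card_halfIdx : Fintype.card (TorusSite 4 L × Fin 3 × Fin 2) = 6 * L ^ 4 := by
  simp only [TorusSite, Fintype.card_prod, Fintype.card_fun, ZMod.card, Fintype.card_fin]
  ring

/-- The Wilson–Dirac operator at positive bare mass is injective (Wilson positivity). -/
theorem wilsonDirac_mulVec_eq_zero (U : GaugeConfig 4 L SU3) {μ : ℝ} (hμ : 0 < μ)
    {v : QuarkIdx L → ℂ} (hv : wilsonDirac (fundamentalRep (Fin 3)) U μ 1 *ᵥ v = 0) : v = 0 := by
  by_contra h0
  have hS := sum_norm_sq_pos h0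
  have h := (re_star_dotProduct_wilsonDirac_mem U μ v).1
  rw [hv, dotProduct_zero, Complex.zero_re] at h
  nlinarith

/-- Core of the inertia count: if more than `6L⁴` eigen-indices satisfy `Q`, some non-zero coefficient
vector supported on `Q` has `V c` (`V` the eigenvector unitary) vanishing on two chosen spin components
`τ 0, τ 1` (a kernel vector of a linear map from `> 6L⁴` to `6L⁴` dimensions). -/
theorem exists_supported_vector {H : Matrix (QuarkIdx L) (QuarkIdx L) ℂ} (hH : H.IsHermitian)
    (Q : QuarkIdx L → Prop) [DecidablePred Q] (hQ : 6 * L ^ 4 < (Finset.univ.filter Q).card)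
    (τ : Fin 2 → Fin 4) :
    ∃ c : QuarkIdx L → ℂ, c ≠ 0 ∧ (∀ i, ¬ Q i → c i = 0) ∧
      ∀ (x : TorusSite 4 L) (a : Fin 3) (j : Fin 2),
        ((hH.eigenvectorUnitary : Matrix (QuarkIdx L) (QuarkIdx L) ℂ) *ᵥ c) (x, a, τ j) = 0 := by
  set V : Matrix (QuarkIdx L) (QuarkIdx L) ℂ :=
    (hH.eigenvectorUnitary : Matrix (QuarkIdx L) (QuarkIdx L) ℂ) with hV
  let I := {i : QuarkIdx L // Q i}
  let ext : (I → ℂ) →ₗ[ℂ] (QuarkIdx L → ℂ) :=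
    { toFun := fun c i => if h : Q i then c ⟨i, h⟩ else 0
      map_add' := fun c d => by
        funext i
        simp only [Pi.add_apply]
        split_ifs <;> simp
      map_smul' := fun r c => by
        funext i
        simp only [Pi.smul_apply, smul_eq_mul, RingHom.id_apply]
        split_ifs <;> simp }
  let T : (I → ℂ) →ₗ[ℂ] (TorusSite 4 L × Fin 3 × Fin 2 → ℂ) :=
    { toFun := fun c q => (V *ᵥ ext c) (q.1, q.2.1, τ q.2.2)
      map_add' := fun c d => by
        funext q
        simp only [map_add, mulVec_add, Pi.add_apply]
      map_smul' := fun r c => by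
        funext q
        simp only [map_smul, mulVec_smul, Pi.smul_apply, RingHom.id_apply] }
  have hdim : Module.finrank ℂ (TorusSite 4 L × Fin 3 × Fin 2 → ℂ) < Module.finrank ℂ (I → ℂ) := by
    rw [Module.finrank_fintype_fun_eq_card, Module.finrank_fintype_fun_eq_card, card_halfIdx,
      Fintype.card_subtype]
    exact hQ
  obtain ⟨c, hcT, hc0⟩ :=
    (Submodule.ne_bot_iff _).mp (LinearMap.ker_ne_bot_of_finrank_lt (f := T) hdim)
  rw [LinearMap.mem_ker] at hcT
  refine ⟨ext c, ?_, fun i hi => ?_, fun x a j => ?_⟩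
  · intro h
    apply hc0
    funext ⟨i, hi⟩
    have := congrFun h i
    simp only [ext, LinearMap.coe_mk, AddHom.coe_mk, dif_pos hi, Pi.zero_apply] at this
    exact this
  · simp only [ext, LinearMap.coe_mk, AddHom.coe_mk, dif_neg hi]
  · have := congrFun hcT (x, a, j)
    simpa [T] using this

/-- **Lyapunov inertia, negative half**: at positive bare mass at most `6L⁴` eigenvalues of
`H = Γ₅ D_W(U,μ,1)` are negative — a vector in the negative spectral subspace with vanishing LOWER
chirality components would have `⟨v,Hv⟩ ≤ 0` and `⟨v,Hv⟩ = Re⟨v,Dv⟩ ≥ μ‖v‖² > 0`. -/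
theorem card_neg_eigenvalues_le (U : GaugeConfig 4 L SU3) {μ : ℝ} (hμ : 0 < μ)
    (hH : (spinorLift gammaFive * wilsonDirac (fundamentalRep (Fin 3)) U μ 1).IsHermitian) :
    (Finset.univ.filter fun i => hH.eigenvalues i < 0).card ≤ 6 * L ^ 4 := by
  by_contra hlt
  push Not at hlt
  set V : Matrix (QuarkIdx L) (QuarkIdx L) ℂ :=
    (hH.eigenvectorUnitary : Matrix (QuarkIdx L) (QuarkIdx L) ℂ) with hV
  have hVV : star V * V = 1 := Matrix.mem_unitaryGroup_iff'.mp hH.eigenvectorUnitary.2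
  obtain ⟨c, hc0, hcsupp, hcτ⟩ := exists_supported_vector hH (fun i => hH.eigenvalues i < 0) hlt ![2, 3]
  set v : QuarkIdx L → ℂ := V *ᵥ c with hvdef
  have hv0 : v ≠ 0 := by
    intro h
    apply hc0
    have : star V *ᵥ v = c := by rw [hvdef, mulVec_mulVec, hVV, one_mulVec]
    rw [← this, h, mulVec_zero]
  have hvlow : ∀ p : QuarkIdx L, (p.2.2 = 2 ∨ p.2.2 = 3) → v p = 0 := by
    rintro ⟨x, a, α⟩ (h | h) <;> simp only at h <;> subst h
    · exact hcτ x a 0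
    · exact hcτ x a 1
  have hQre : (star v ⬝ᵥ ((spinorLift gammaFive * wilsonDirac (fundamentalRep (Fin 3)) U μ 1) *ᵥ v)).re
      ≤ 0 := by
    rw [hvdef, quadForm_eigenvectorUnitary_mulVec hH c, Complex.re_sum]
    refine Finset.sum_nonpos fun i _ => ?_
    rw [← Complex.ofReal_pow, ← Complex.ofReal_mul, Complex.ofReal_re]
    by_cases hi : hH.eigenvalues i < 0
    · exact mul_nonpos_of_nonpos_of_nonneg hi.le (by positivity)
    · rw [hcsupp i hi, norm_zero]; simp
  rw [← mulVec_mulVec, dotProduct_gammaFive_mulVec_of_lower_eq_zero v _ hvlow] at hQre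
  have hpos := (re_star_dotProduct_wilsonDirac_mem U μ v).1
  have hS := sum_norm_sq_pos hv0
  nlinarith

/-- **Lyapunov inertia, positive half**: at most `6L⁴` positive eigenvalues (UPPER components zero
gives `⟨v,Hv⟩ = -Re⟨v,Dv⟩ < 0` against `⟨v,Hv⟩ ≥ 0`). -/
theorem card_pos_eigenvalues_le (U : GaugeConfig 4 L SU3) {μ : ℝ} (hμ : 0 < μ)
    (hH : (spinorLift gammaFive * wilsonDirac (fundamentalRep (Fin 3)) U μ 1).IsHermitian) :
    (Finset.univ.filter fun i => 0 < hH.eigenvalues i).card ≤ 6 * L ^ 4 := by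
  by_contra hlt
  push Not at hlt
  set V : Matrix (QuarkIdx L) (QuarkIdx L) ℂ :=
    (hH.eigenvectorUnitary : Matrix (QuarkIdx L) (QuarkIdx L) ℂ) with hV
  have hVV : star V * V = 1 := Matrix.mem_unitaryGroup_iff'.mp hH.eigenvectorUnitary.2
  obtain ⟨c, hc0, hcsupp, hcτ⟩ := exists_supported_vector hH (fun i => 0 < hH.eigenvalues i) hlt ![0, 1]
  set v : QuarkIdx L → ℂ := V *ᵥ c with hvdef
  have hv0 : v ≠ 0 := by
    intro h
    apply hc0
    have : star V *ᵥ v = c := by rw [hvdef, mulVec_mulVec, hVV, one_mulVec]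
    rw [← this, h, mulVec_zero]
  have hvup : ∀ p : QuarkIdx L, (p.2.2 = 0 ∨ p.2.2 = 1) → v p = 0 := by
    rintro ⟨x, a, α⟩ (h | h) <;> simp only at h <;> subst h
    · exact hcτ x a 0
    · exact hcτ x a 1
  have hQre : 0 ≤
      (star v ⬝ᵥ ((spinorLift gammaFive * wilsonDirac (fundamentalRep (Fin 3)) U μ 1) *ᵥ v)).re := by
    rw [hvdef, quadForm_eigenvectorUnitary_mulVec hH c, Complex.re_sum]
    refine Finset.sum_nonneg fun i _ => ?_
    rw [← Complex.ofReal_pow, ← Complex.ofReal_mul, Complex.ofReal_re]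
    by_cases hi : 0 < hH.eigenvalues i
    · exact mul_nonneg hi.le (by positivity)
    · rw [hcsupp i hi, norm_zero]; simp
  rw [← mulVec_mulVec, dotProduct_gammaFive_mulVec_of_upper_eq_zero v _ hvup, Complex.neg_re] at hQre
  have hpos := (re_star_dotProduct_wilsonDirac_mem U μ v).1
  have hS := sum_norm_sq_pos hv0
  nlinarith

/-- **The index vanishes at positive bare mass.**  For every torus side `L ≥ 1`, every `SU(3)`
field and every `μ > 0`, exactly half (`6L⁴` of `12L⁴`) of the eigenvalues of `Γ₅ D_W(U,μ,1)` are
negative: the TIGHT integrand `|n₋ − 6(2L_k+1)⁴|` of `WindowExtinction` is identically `0` at any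
positive TIGHT mass.  (Ostrowski–Schneider inertia: `HΓ₅ + Γ₅H = D + Dᴴ ≻ 0`.) -/
theorem negEigenvalueCount_eq_half (U : GaugeConfig 4 L SU3) {μ : ℝ} (hμ : 0 < μ)
    [DecidablePred fun z : ℂ => z.re < 0] :
    Multiset.countP (fun z : ℂ => z.re < 0)
      (spinorLift gammaFive * wilsonDirac (fundamentalRep (Fin 3)) U μ 1).charpoly.roots =
        6 * L ^ 4 := by
  set H := spinorLift gammaFive * wilsonDirac (fundamentalRep (Fin 3)) U μ 1 with hHdef
  have hH : H.IsHermitian :=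
    Literature.Barriers.QuantumFields.isHermitian_gammaFive_mul_wilsonDirac (fundamentalRep (Fin 3))
      fundamentalRep_mem_unitaryGroup U μ 1
  -- countP over the roots = number of negative eigenvalues
  have h1 : Multiset.countP (fun z : ℂ => z.re < 0) H.charpoly.roots =
      (Finset.univ.filter fun i => hH.eigenvalues i < 0).card := by
    rw [hH.roots_charpoly_eq_eigenvalues, Multiset.countP_map, Finset.card_def, Finset.filter_val]
    congr 1
    refine Multiset.filter_congr fun i _ => ?_
    simp
  rw [h1]
  -- no zero eigenvalue: `det H ≠ 0`
  have hdetD : (wilsonDirac (fundamentalRep (Fin 3)) U μ 1).det ≠ 0 := by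
    intro h0
    obtain ⟨v, hv0, hv⟩ := Matrix.exists_mulVec_eq_zero_iff.mpr h0
    exact hv0 (wilsonDirac_mulVec_eq_zero U hμ hv)
  have hdetΓ : (spinorLift gammaFive : Matrix (QuarkIdx L) (QuarkIdx L) ℂ).det ≠ 0 := by
    intro h0
    have h := congrArg Matrix.det (spinorLift_gammaFive_mul_self (L := L) (N := 3))
    rw [det_mul, h0, zero_mul, det_one] at h
    exact zero_ne_one h
  have hne : ∀ i, hH.eigenvalues i ≠ 0 := by
    have hdetH : H.det ≠ 0 := by rw [hHdef, det_mul]; exact mul_ne_zero hdetΓ hdetD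
    rw [hH.det_eq_prod_eigenvalues, Finset.prod_ne_zero_iff] at hdetH
    intro i hi
    exact hdetH i (Finset.mem_univ i) (by rw [hi]; simp)
  -- counting
  set sneg := Finset.univ.filter fun i => hH.eigenvalues i < 0 with hsneg
  set spos := Finset.univ.filter fun i => 0 < hH.eigenvalues i with hspos
  have hle : sneg.card ≤ 6 * L ^ 4 := card_neg_eigenvalues_le U hμ hH
  have hle' : spos.card ≤ 6 * L ^ 4 := card_pos_eigenvalues_le U hμ hH
  have hcover : sneg ∪ spos = Finset.univ := by
    ext i
    simp only [hsneg, hspos, Finset.mem_union, Finset.mem_filter, Finset.mem_univ, true_and,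
      iff_true]
    exact (hne i).lt_or_gt
  have hdisj : Disjoint sneg spos := by
    rw [hsneg, hspos, Finset.disjoint_filter]
    intro i _ h
    exact not_lt.mpr h.le
  have hcard : sneg.card + spos.card = 12 * L ^ 4 := by
    rw [← Finset.card_union_of_disjoint hdisj, hcover, Finset.card_univ, card_quarkIdx]
  omega

/-- **TIGHT pins the critical-mass datum below the window.**  If a regularisation `reg` satisfies the
TIGHT clause of `WindowExtinction` (verbatim, threshold `M₀`, weights at the mass tuple `m`), then for
every `M > M₀`, eventually `m_crit(k) ≤ a_k M / Z_m(k)`: at any step where the TIGHT mass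
`m_crit(k) − a_k M/Z_m(k)` is positive the index integrand vanishes identically
(`negEigenvalueCount_eq_half`), the ratio is `0 < 1`.  Since `a_k/Z_m(k) → 0` this forces
`limsup m_crit(k) ≤ 0`; together with `extinct_step_of_mcrit_nonneg` it localises every witness of
`WindowExtinction` to `m_crit(k) ∈ (-∞, a_k M₀⁺/Z_m(k)]`, the EXTINCT-trivial half-space being
`[0, ∞)`: the two clauses overlap only in the sliver `0 ≤ m_crit(k) ≤ a_k M₀/Z_m(k)` plus the
genuinely negative (physical) region. -/
theorem mcrit_le_window_of_tight {Nf : ℕ} (reg : QCDRegularisation Nf) (M₀ : ℝ) (m : Fin Nf → ℝ)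
    (hT : ∀ M : ℝ, M₀ < M → ∀ᶠ k : ℕ in Filter.atTop, 1 ≤ (∫ U, (|(Multiset.countP (fun z : ℂ => z.re < 0) (spinorLift gammaFive * wilsonDirac (fundamentalRep (Fin 3)) U (reg.mcrit k - reg.a k * M / reg.Zm k) 1).charpoly.roots : ℝ) - 6 * (2 * reg.L k + 1 : ℝ) ^ 4|) * ∏ f : Fin Nf, ‖fermionDet (wilsonDirac (fundamentalRep (Fin 3)) U (reg.mcrit k + reg.a k * m f / reg.Zm k) 1)‖ ∂(wilsonMeasure (d := 4) (L := 2 * reg.L k + 1) (fundamentalRep (Fin 3)) (reg.β k))) / (∫ U, ∏ f : Fin Nf, ‖fermionDet (wilsonDirac (fundamentalRep (Fin 3)) U (reg.mcrit k + reg.a k * m f / reg.Zm k) 1)‖ ∂(wilsonMeasure (d := 4) (L := 2 * reg.L k + 1) (fundamentalRep (Fin 3)) (reg.β k))))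
    (M : ℝ) (hM : M₀ < M) : ∀ᶠ k : ℕ in Filter.atTop, reg.mcrit k ≤ reg.a k * M / reg.Zm k := by
  filter_upwards [hT M hM] with k hk
  by_contra hlt
  push Not at hlt
  have hμ : 0 < reg.mcrit k - reg.a k * M / reg.Zm k := by linarith
  have hnum : (∫ U, (|(Multiset.countP (fun z : ℂ => z.re < 0) (spinorLift gammaFive * wilsonDirac (fundamentalRep (Fin 3)) U (reg.mcrit k - reg.a k * M / reg.Zm k) 1).charpoly.roots : ℝ) - 6 * (2 * reg.L k + 1 : ℝ) ^ 4|) * ∏ f : Fin Nf, ‖fermionDet (wilsonDirac (fundamentalRep (Fin 3)) U (reg.mcrit k + reg.a k * m f / reg.Zm k) 1)‖ ∂(wilsonMeasure (d := 4) (L := 2 * reg.L k + 1) (fundamentalRep (Fin 3)) (reg.β k))) = 0 := by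
    refine integral_eq_zero_of_ae (Eventually.of_forall fun U => ?_)
    simp only [Pi.zero_apply]
    refine mul_eq_zero_of_left ?_ _
    rw [negEigenvalueCount_eq_half U hμ]
    push_cast
    rw [sub_self, abs_zero]
  rw [hnum, zero_div] at hk
  exact absurd hk (by norm_num)



/-- The pin in clause form (sibling file's `Tight`). -/
theorem mcrit_le_window_of_tightClause {Nf : ℕ} {reg : QCDRegularisation Nf} {M₀ : ℝ}
    {m : Fin Nf → ℝ} (hT : Tight Nf reg M₀ m) (M : ℝ) (hM : M₀ < M) :
    ∀ᶠ k : ℕ in Filter.atTop, reg.mcrit k ≤ reg.a k * M / reg.Zm k :=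
  mcrit_le_window_of_tight reg M₀ m hT M hM

/-- **The pin read off the route decl**: every witness of `WindowExtinction` (at `N_f = 2`, say) comes
with a threshold `M₀` such that `m_crit(k) ≤ a_k M/Z_m(k)` eventually, for every `M > M₀`. -/
theorem windowExtinction_mcrit_le_window (h : WindowExtinction) (Nf : ℕ) (hNf : Nf = 2 ∨ Nf = 3) :
    ∃ reg : QCDRegularisation Nf, ∃ M₀ : ℝ, 0 ≤ M₀ ∧
      ∀ M : ℝ, M₀ < M → ∀ᶠ k : ℕ in Filter.atTop, reg.mcrit k ≤ reg.a k * M / reg.Zm k := by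
  -- buildfix 2026-08-19: `WindowExtinction` was restated (route rev 9, SD⁺: volume cap, branch clause, extensive
  -- TIGHT `max 1 (η (a_k(2L_k+1))²) ≤ ratio`); destructure the decl directly and weaken TIGHT⁺ to the clause `Tight`.
  obtain ⟨reg, -, -, -, -, M₀, hM₀, c, -, hm⟩ := h Nf hNf
  refine ⟨reg, M₀, hM₀, fun M hM => ?_⟩
  have hm1 : ∀ f : Fin Nf, M₀ < (fun _ => M₀ + 1) f := fun _ => by simp
  obtain ⟨-, η, -, hT⟩ := hm _ hm1
  have hT' : Tight Nf reg M₀ (fun _ => M₀ + 1) := fun M' hM' => by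
    filter_upwards [hT M' hM'] with k hk
    exact le_trans (le_max_left _ _) hk
  exact mcrit_le_window_of_tightClause hT' M hM

end Summit.QuantumFields.QCD.Theorems.TipPricing.Negative
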